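import Literature.NumberTheory.NumberFields.EisensteinField
import Mathlib.NumberTheory.NumberField.Cyclotomic.Basic
import Mathlib.NumberTheory.NumberField.Cyclotomic.Three
import Mathlib.NumberTheory.NumberField.Cyclotomic.PID
import Mathlib.NumberTheory.NumberField.Cyclotomic.Ideal
import HarnessLib

/-!
# The Eisenstein integers `ℤ[ζ₃] = 𝓞 ℚ(ζ₃)`: coordinates, the primes `2`, `5`, `1 − ζ₃`, units

Topic `NumberTheory/NumberFields`. Sequel of `EisensteinField.lean` (the model
`K3 = ℚ[ω]/(ω² + ω + 1)` of `ℚ(ζ₃)`, `ζ = ω`). The arithmetic of `𝓞 K3` needed to make the group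
`K(S, 3)` (`S` = the places above `30`) of the `√−3`-descent on the cubic twists
`y² = x³ + (2^a 5^b)²` explicit
(`Literature/Barriers/BirchSwinnertonDyer/RankNotSumOfLocalInvariantsCubicTwists.lean`):

* `K3.isIntegral_iff`: `x ∈ 𝓞 K3 ↔ x = a + bζ` with `a, b ∈ ℤ` (`𝓞 ℚ(ζ₃) = ℤ[ζ₃]`, Mathlib's
  `IsCyclotomicExtension.Rat.isIntegralClosure_adjoin_singleton_of_prime`); the integers
  `K3.mkInt a b = a + bζ ∈ 𝓞 K3` and their norm `a² − ab + b²` (`norm_mkInt`);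
* `K3.instIsPrincipalIdealRing`: `𝓞 K3` is a PID (Mathlib, `IsCyclotomicExtension.Rat.three_pid`);
* `K3.prime_two`, `K3.prime_five`: `2` and `5` are prime in `𝓞 K3` (inert: `a² − ab + b² ≠ 2, 5`),
  `K3.prime_lamInt`: `λ = ζ − 1` is prime (Mathlib, `IsPrimitiveRoot.zeta_sub_one_prime'`), with
  `3 = −ζ²λ²` (`three_eq_neg_eta_sq_mul_lamInt_sq`) and the (non-)divisibilities among `2, 5, λ`
  (`intCast_dvd_mkInt_iff`, `lamInt_dvd_mkInt_iff`: `λ ∣ a + bζ ↔ 3 ∣ a + b`);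
* `K3.exists_coe_unit_eq`: every unit of `𝓞 K3` is `±ζ^i`, `i < 3` (Mathlib,
  `IsCyclotomicExtension.Rat.Three.Units.mem`);
* `K3.associated_of_prime_of_dvd_thirty`: a prime element dividing `30` is associated to `λ`, `2`
  or `5` — the hypothesis of the tree's `K(S, n)` lemma
  (`Literature/NumberTheory/NumberFields/SelmerGroupPID*.lean`) for `S = {λ, 2, 5}`.

All [folklore] / Mathlib repackaged; Ireland–Rosen Ch. 9 §1 for the arithmetic of `ℤ[ω]`.

## References

* K. Ireland, M. Rosen, *A Classical Introduction to Modern Number Theory*, 2nd ed., GTM 84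
  (1990), Ch. 9 §1, Prop. 9.1.1–9.1.4 (`ℤ[ω]` is a PID with units `±1, ±ω, ±ω²`; `1 − ω` is
  prime and `3 = −ω²(1 − ω)²`; a rational prime `p ≡ 2 (mod 3)` stays prime). [IrelandRosen1990]
-/

noncomputable section

open QuadraticAlgebra NumberField

namespace Literature.NumberTheory.NumberFields

namespace K3

/-! ### `𝓞 K3 = ℤ[ζ]`: integer coordinates -/

/-- The elements of `K3` with integer coordinates form a `ℤ`-subalgebra (`ℤ[ζ]`). [folklore] -/
def intCoords : Subalgebra ℤ K3 where
  carrier := {x | ∃ a b : ℤ, x = ⟨a, b⟩}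
  mul_mem' := by
    rintro _ _ ⟨a, b, rfl⟩ ⟨c, d, rfl⟩
    exact ⟨a * c - b * d, a * d + b * c - b * d, by ext <;> simp <;> ring⟩
  one_mem' := ⟨1, 0, by ext <;> simp⟩
  add_mem' := by
    rintro _ _ ⟨a, b, rfl⟩ ⟨c, d, rfl⟩
    exact ⟨a + c, b + d, by ext <;> simp⟩
  zero_mem' := ⟨0, 0, by ext <;> simp⟩
  algebraMap_mem' n := ⟨n, 0, by ext <;> simp⟩

/-- Membership in `intCoords`. [folklore] -/
theorem mem_intCoords_iff {x : K3} : x ∈ intCoords ↔ ∃ a b : ℤ, x = ⟨a, b⟩ := Iff.rfl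

/-- `ζ ∈ ℤ[ζ]`. [folklore] -/
theorem zeta_mem_intCoords : zeta ∈ intCoords := ⟨0, 1, by rw [zeta_eq]; ext <;> simp⟩

/-- `a + bζ` is an algebraic integer. [folklore] -/
theorem isIntegral_mk (a b : ℤ) : IsIntegral ℤ (⟨a, b⟩ : K3) := by
  rw [mk_eq]
  refine IsIntegral.add isIntegral_algebraMap (IsIntegral.mul isIntegral_algebraMap ?_)
  exact isPrimitiveRoot_zeta.isIntegral (by norm_num)

/-- **`𝓞 ℚ(ζ₃) = ℤ[ζ₃]` in coordinates**: `x ∈ K3` is an algebraic integer iff `x = a + bζ` with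
`a, b ∈ ℤ` (Mathlib: the ring of integers of a prime cyclotomic field is `ℤ[ζ]`).
[cite: IrelandRosen1990, Ch. 9 §1] -/
theorem isIntegral_iff {x : K3} : IsIntegral ℤ x ↔ ∃ a b : ℤ, x = ⟨a, b⟩ := by
  refine ⟨fun hx ↦ ?_, ?_⟩
  · haveI := IsCyclotomicExtension.Rat.isIntegralClosure_adjoin_singleton_of_prime
      (p := 3) (K := K3) isPrimitiveRoot_zeta
    obtain ⟨y, rfl⟩ := (IsIntegralClosure.isIntegral_iff (A := Algebra.adjoin ℤ ({zeta} : Set K3))).mp hx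
    have hle : Algebra.adjoin ℤ ({zeta} : Set K3) ≤ intCoords :=
      Algebra.adjoin_le (Set.singleton_subset_iff.mpr zeta_mem_intCoords)
    exact hle y.2
  · rintro ⟨a, b, rfl⟩
    exact isIntegral_mk a b

/-- `a + bζ` lies in the integral closure of `ℤ`. [folklore] -/
theorem mk_mem_integralClosure (a b : ℤ) : (⟨a, b⟩ : K3) ∈ integralClosure ℤ K3 :=
  isIntegral_mk a b

/-- The integer `a + bζ ∈ 𝓞 K3`. [folklore] -/
def mkInt (a b : ℤ) : 𝓞 K3 := ⟨⟨a, b⟩, mk_mem_integralClosure a b⟩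

/-- `mkInt a b = a + bζ` in `K3`. [folklore] -/
@[simp] theorem coe_mkInt (a b : ℤ) : ((mkInt a b : 𝓞 K3) : K3) = ⟨a, b⟩ := rfl

/-- `mkInt a b = a + bζ` in `K3` (`algebraMap` form). [folklore] -/
@[simp] theorem algebraMap_mkInt (a b : ℤ) : algebraMap (𝓞 K3) K3 (mkInt a b) = ⟨a, b⟩ := rfl

/-- Every algebraic integer of `K3` is some `a + bζ`. [folklore] -/
theorem exists_eq_mkInt (y : 𝓞 K3) : ∃ a b : ℤ, y = mkInt a b := by
  obtain ⟨a, b, h⟩ := isIntegral_iff.mp y.isIntegral_coe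
  exact ⟨a, b, RingOfIntegers.ext h⟩

/-- `mkInt` is additive. [folklore] -/
theorem mkInt_add (a b c d : ℤ) : mkInt a b + mkInt c d = mkInt (a + c) (b + d) := by
  unfold mkInt
  ext <;> simp

/-- `mkInt` is multiplicative: `(a + bζ)(c + dζ) = (ac − bd) + (ad + bc − bd)ζ`. [folklore] -/
theorem mkInt_mul (a b c d : ℤ) :
    mkInt a b * mkInt c d = mkInt (a * c - b * d) (a * d + b * c - b * d) := by
  unfold mkInt
  ext <;> simp <;> ring

/-- `mkInt` is injective. [folklore] -/
theorem mkInt_inj {a b c d : ℤ} : mkInt a b = mkInt c d ↔ a = c ∧ b = d := by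
  rw [← RingOfIntegers.eq_iff, coe_mkInt, coe_mkInt, QuadraticAlgebra.ext_iff]
  simp

/-- `mkInt n 0 = n`. [folklore] -/
theorem mkInt_intCast (n : ℤ) : mkInt n 0 = (n : 𝓞 K3) := by
  apply RingOfIntegers.ext
  change (⟨(n : ℚ), ((0 : ℤ) : ℚ)⟩ : K3) = ((n : 𝓞 K3) : K3)
  push_cast; ext <;> simp

/-- `mkInt a b = 0 ↔ a = 0 ∧ b = 0`. [folklore] -/
theorem mkInt_eq_zero_iff (a b : ℤ) : mkInt a b = 0 ↔ a = 0 ∧ b = 0 := by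
  rw [← RingOfIntegers.eq_iff, coe_mkInt]
  push_cast
  constructor
  · intro h
    have h1 := congrArg QuadraticAlgebra.re h
    have h2 := congrArg QuadraticAlgebra.im h
    simp at h1 h2
    exact ⟨h1, h2⟩
  · rintro ⟨rfl, rfl⟩; ext <;> simp

/-! ### The norm `a² − ab + b²` -/

/-- `N(a + bζ) = a² − ab + b²`. [cite: IrelandRosen1990, Ch. 9 §1] -/
theorem norm_mk (a b : ℚ) : QuadraticAlgebra.norm (⟨a, b⟩ : K3) = a ^ 2 - a * b + b ^ 2 := by
  rw [norm_def]; ring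

/-- The norm is positive definite: `a² − ab + b² = 0 ↔ a = b = 0`. [folklore] -/
theorem norm_int_eq_zero_iff (a b : ℤ) : a ^ 2 - a * b + b ^ 2 = 0 ↔ a = 0 ∧ b = 0 := by
  constructor
  · intro h
    have h4 : (2 * a - b) ^ 2 + 3 * b ^ 2 = 0 := by linear_combination 4 * h
    have hb2 : b ^ 2 = 0 := by nlinarith [sq_nonneg (2 * a - b), sq_nonneg b]
    have hb : b = 0 := pow_eq_zero_iff two_ne_zero |>.mp hb2
    subst hb
    have ha2 : a ^ 2 = 0 := by nlinarith
    exact ⟨pow_eq_zero_iff two_ne_zero |>.mp ha2, rfl⟩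
  · rintro ⟨rfl, rfl⟩; simp

/-- The norm is positive on non-zero integers. [folklore] -/
theorem norm_int_pos {a b : ℤ} (h : ¬ (a = 0 ∧ b = 0)) : 0 < a ^ 2 - a * b + b ^ 2 := by
  rcases (lt_trichotomy 0 (a ^ 2 - a * b + b ^ 2)) with hlt | heq | hgt
  · exact hlt
  · exact absurd ((norm_int_eq_zero_iff a b).mp heq.symm) h
  · nlinarith [sq_nonneg (2 * a - b), sq_nonneg b]

/-- **Multiplicativity of the norm in coordinates.** [folklore] -/
theorem norm_int_mul (a b c d : ℤ) :
    (a * c - b * d) ^ 2 - (a * c - b * d) * (a * d + b * c - b * d) + (a * d + b * c - b * d) ^ 2 =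
      (a ^ 2 - a * b + b ^ 2) * (c ^ 2 - c * d + d ^ 2) := by
  ring

/-- An integer of norm `1` is a unit: `(a + bζ)((a − b) − bζ) = a² − ab + b²`. [folklore] -/
theorem isUnit_mkInt_of_norm_eq_one {a b : ℤ} (h : a ^ 2 - a * b + b ^ 2 = 1) :
    IsUnit (mkInt a b) := by
  refine IsUnit.of_mul_eq_one (mkInt (a - b) (-b)) ?_
  rw [mkInt_mul, ← mkInt_intCast 1 |>.trans Int.cast_one]
  congr 1
  · linear_combination h
  · ring

/-- `a² − ab + b² ≠ 2`. [cite: IrelandRosen1990, Prop. 9.1.4] -/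
theorem norm_int_ne_two (a b : ℤ) : a ^ 2 - a * b + b ^ 2 ≠ 2 := by
  intro h
  have hb : b ^ 2 ≤ 2 := by nlinarith [sq_nonneg (2 * a - b)]
  have hb1 : -1 ≤ b ∧ b ≤ 1 := by constructor <;> nlinarith
  have ha : a ^ 2 ≤ 2 := by nlinarith [sq_nonneg (2 * b - a)]
  have ha1 : -1 ≤ a ∧ a ≤ 1 := by constructor <;> nlinarith
  obtain ⟨hb1, hb2⟩ := hb1
  obtain ⟨ha1, ha2⟩ := ha1
  interval_cases a <;> interval_cases b <;> omega

/-- `a² − ab + b² ≠ 5`. [cite: IrelandRosen1990, Prop. 9.1.4] -/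
theorem norm_int_ne_five (a b : ℤ) : a ^ 2 - a * b + b ^ 2 ≠ 5 := by
  intro h
  have hb : b ^ 2 ≤ 6 := by nlinarith [sq_nonneg (2 * a - b)]
  have hb1 : -2 ≤ b ∧ b ≤ 2 := by constructor <;> nlinarith
  have ha : a ^ 2 ≤ 6 := by nlinarith [sq_nonneg (2 * b - a)]
  have ha1 : -2 ≤ a ∧ a ≤ 2 := by constructor <;> nlinarith
  obtain ⟨hb1, hb2⟩ := hb1
  obtain ⟨ha1, ha2⟩ := ha1
  interval_cases a <;> interval_cases b <;> omega

/-! ### `𝓞 K3` is a principal ideal domain; the inert primes `2` and `5` -/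

/-- **`𝓞 ℚ(ζ₃)` is a principal ideal domain** (Mathlib). [cite: IrelandRosen1990, Prop. 9.1.2] -/
instance instIsPrincipalIdealRing : IsPrincipalIdealRing (𝓞 K3) :=
  IsCyclotomicExtension.Rat.three_pid K3

/-- Divisibility by a rational integer is coordinatewise: `m ∣ a + bζ ↔ m ∣ a ∧ m ∣ b`.
[folklore] -/
theorem intCast_dvd_mkInt_iff (m a b : ℤ) :
    (m : 𝓞 K3) ∣ mkInt a b ↔ m ∣ a ∧ m ∣ b := by
  constructor
  · rintro ⟨c, hc⟩
    obtain ⟨x, y, rfl⟩ := exists_eq_mkInt c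
    rw [← mkInt_intCast, mkInt_mul] at hc
    have h := congrArg (fun z : 𝓞 K3 ↦ (z : K3)) hc
    simp only [coe_mkInt] at h
    have h1 := congrArg QuadraticAlgebra.re h
    have h2 := congrArg QuadraticAlgebra.im h
    simp at h1 h2
    exact ⟨⟨x, by exact_mod_cast h1⟩, ⟨y, by exact_mod_cast h2⟩⟩
  · rintro ⟨⟨x, rfl⟩, ⟨y, rfl⟩⟩
    exact ⟨mkInt x y, by rw [← mkInt_intCast, mkInt_mul]; congr 1 <;> ring⟩

/-- A rational prime `p` with `a² − ab + b² ≠ p` for all integers `a, b` (an inert prime) is a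
prime element of `𝓞 K3`: it is irreducible by the norm, and `𝓞 K3` is a PID.
[cite: IrelandRosen1990, Prop. 9.1.4] -/
theorem prime_intCast_of_norm_ne {p : ℕ} (hp : p.Prime)
    (hne : ∀ a b : ℤ, a ^ 2 - a * b + b ^ 2 ≠ p) : Prime ((p : ℤ) : 𝓞 K3) := by
  have hp0 : (p : ℤ) ≠ 0 := by exact_mod_cast hp.ne_zero
  have hp1 : (p : ℤ) ≠ 1 := by exact_mod_cast hp.ne_one
  refine (UniqueFactorizationMonoid.irreducible_iff_prime).mp ⟨?_, ?_⟩
  · -- not a unit: `p c = 1` forces `p ∣ 1`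
    intro hu
    obtain ⟨c, hc⟩ := hu.exists_right_inv
    have hdvd : ((p : ℤ) : 𝓞 K3) ∣ mkInt 1 0 := ⟨c, by rw [mkInt_intCast, Int.cast_one, hc]⟩
    rw [intCast_dvd_mkInt_iff] at hdvd
    exact hp1 (Int.eq_one_of_dvd_one (by positivity) hdvd.1)
  · intro x y hxy
    obtain ⟨a, b, rfl⟩ := exists_eq_mkInt x
    obtain ⟨c, d, rfl⟩ := exists_eq_mkInt y
    -- norms: `p² = N(x) N(y)`
    have hN : ((p : ℤ) ^ 2 : ℤ) = (a ^ 2 - a * b + b ^ 2) * (c ^ 2 - c * d + d ^ 2) := by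
      rw [mkInt_mul, ← mkInt_intCast, mkInt_inj] at hxy
      obtain ⟨h1, h2⟩ := hxy
      rw [← norm_int_mul, ← h1, ← h2]; ring
    have hx0 : ¬ (a = 0 ∧ b = 0) := by
      rintro ⟨rfl, rfl⟩; simp at hN; exact hp.ne_zero hN
    have hy0 : ¬ (c = 0 ∧ d = 0) := by
      rintro ⟨rfl, rfl⟩; simp at hN; exact hp.ne_zero hN
    have hxpos := norm_int_pos hx0
    have hypos := norm_int_pos hy0
    -- the positive divisors of `p²` are `1, p, p²`
    have hdvd : (a ^ 2 - a * b + b ^ 2) ∣ (p : ℤ) ^ 2 := Dvd.intro _ hN.symm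
    have hprime : Prime (p : ℤ) := Nat.prime_iff_prime_int.mp hp
    rcases (dvd_prime_pow hprime 2).mp hdvd with ⟨i, hi, hassoc⟩
    have habs := Int.eq_of_associated_of_nonneg hassoc hxpos.le (by positivity)
    interval_cases i
    · left; exact isUnit_mkInt_of_norm_eq_one (by simpa using habs)
    · exact absurd (by simpa using habs) (hne a b)
    · right
      rw [habs] at hN
      have h1 : c ^ 2 - c * d + d ^ 2 = 1 := by
        have : (p : ℤ) ^ 2 * (c ^ 2 - c * d + d ^ 2 - 1) = 0 := by linear_combination -hN
        rcases mul_eq_zero.mp this with h | h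
        · exact absurd (pow_eq_zero_iff two_ne_zero |>.mp h) hp0
        · linear_combination h
      exact isUnit_mkInt_of_norm_eq_one h1

/-- **`2` is prime in `𝓞 ℚ(ζ₃)`** (inert). [cite: IrelandRosen1990, Prop. 9.1.4] -/
theorem prime_two : Prime (2 : 𝓞 K3) := by
  have := prime_intCast_of_norm_ne Nat.prime_two (fun a b ↦ by exact_mod_cast norm_int_ne_two a b)
  simpa using this

/-- **`5` is prime in `𝓞 ℚ(ζ₃)`** (inert). [cite: IrelandRosen1990, Prop. 9.1.4] -/
theorem prime_five : Prime (5 : 𝓞 K3) := by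
  have := prime_intCast_of_norm_ne (by decide : Nat.Prime 5)
    (fun a b ↦ by exact_mod_cast norm_int_ne_five a b)
  simpa using this

/-! ### The ramified prime `λ = ζ − 1` -/

/-- `ζ` as an algebraic integer (Mathlib's `IsPrimitiveRoot.toInteger`). [folklore] -/
abbrev zetaInt : 𝓞 K3 := isPrimitiveRoot_zeta.toInteger

/-- `λ = ζ − 1 ∈ 𝓞 K3`, the prime above `3`. [cite: IrelandRosen1990, Prop. 9.1.4] -/
abbrev lamInt : 𝓞 K3 := isPrimitiveRoot_zeta.toInteger - 1

/-- `(ζ : K3) = ζ`. [folklore] -/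
@[simp] theorem coe_zetaInt : ((zetaInt : 𝓞 K3) : K3) = zeta := rfl

/-- `(λ : K3) = ζ − 1`. [folklore] -/
@[simp] theorem coe_lamInt : ((lamInt : 𝓞 K3) : K3) = zeta - 1 := rfl

/-- `ζ = mkInt 0 1`. [folklore] -/
theorem zetaInt_eq : zetaInt = mkInt 0 1 := RingOfIntegers.ext (by rw [coe_zetaInt, coe_mkInt, zeta_eq]; simp)

/-- `λ = mkInt (−1) 1`. [folklore] -/
theorem lamInt_eq : lamInt = mkInt (-1) 1 :=
  RingOfIntegers.ext (by rw [coe_lamInt, coe_mkInt, zeta_eq]; ext <;> simp)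

/-- **`λ = ζ − 1` is prime** (Mathlib, `IsPrimitiveRoot.zeta_sub_one_prime'`).
[cite: IrelandRosen1990, Prop. 9.1.4] -/
theorem prime_lamInt : Prime lamInt := isPrimitiveRoot_zeta.zeta_sub_one_prime'

/-- `λ ∣ n ↔ 3 ∣ n` for a rational integer `n` (Mathlib). [cite: IrelandRosen1990, Ch. 9 §1] -/
theorem lamInt_dvd_intCast_iff (n : ℤ) : lamInt ∣ (n : 𝓞 K3) ↔ (3 : ℤ) ∣ n := by
  have h := IsCyclotomicExtension.Rat.zeta_sub_one_dvd_intCast_iff' 3 isPrimitiveRoot_zeta (n := n)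
  exact_mod_cast h

/-- **`λ ∣ a + bζ ↔ 3 ∣ a + b`** (`a + bζ = (a + b) + bλ`). [cite: IrelandRosen1990, Ch. 9 §1] -/
theorem lamInt_dvd_mkInt_iff (a b : ℤ) : lamInt ∣ mkInt a b ↔ (3 : ℤ) ∣ a + b := by
  have h : mkInt a b = ((a + b : ℤ) : 𝓞 K3) + mkInt b 0 * lamInt := by
    rw [lamInt_eq, mkInt_mul, ← mkInt_intCast, mkInt_add]; congr 1 <;> ring
  rw [h, ← lamInt_dvd_intCast_iff]
  exact ⟨fun hd ↦ (dvd_add_left (dvd_mul_left _ _)).mp hd, fun hd ↦ dvd_add hd (dvd_mul_left _ _)⟩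

/-- `3 = −ζ²λ²` in `𝓞 K3`. [cite: IrelandRosen1990, Prop. 9.1.4] -/
theorem three_eq_neg_zetaInt_sq_mul_lamInt_sq : (3 : 𝓞 K3) = -(zetaInt ^ 2 * lamInt ^ 2) := by
  apply RingOfIntegers.ext
  push_cast
  change (3 : K3) = -(zeta ^ 2 * (zeta - 1) ^ 2)
  rw [show (zeta - 1 : K3) = -lam by rw [lam]; ring, neg_sq, three_eq]

/-! ### Units -/

/-- **Every unit of `𝓞 ℚ(ζ₃)` is `±ζ^i`, `i < 3`** (Mathlib, `IsCyclotomicExtension.Rat.Three.Units.mem`).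
[cite: IrelandRosen1990, Prop. 9.1.3] -/
theorem exists_coe_unit_eq (u : (𝓞 K3)ˣ) :
    ∃ (s : ℤ) (i : ℕ), (s = 1 ∨ s = -1) ∧ i < 3 ∧ ((u : 𝓞 K3) : K3) = s * zeta ^ i := by
  have h := IsCyclotomicExtension.Rat.Three.Units.mem isPrimitiveRoot_zeta u
  simp only [List.mem_cons, List.not_mem_nil, or_false] at h
  rcases h with rfl | rfl | rfl | rfl | rfl | rfl
  · exact ⟨1, 0, Or.inl rfl, by norm_num, by simp⟩
  · exact ⟨-1, 0, Or.inr rfl, by norm_num, by simp⟩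
  · exact ⟨1, 1, Or.inl rfl, by norm_num, by simp [IsUnit.unit_spec]⟩
  · exact ⟨-1, 1, Or.inr rfl, by norm_num, by simp [IsUnit.unit_spec]⟩
  · exact ⟨1, 2, Or.inl rfl, by norm_num, by simp [IsUnit.unit_spec]⟩
  · exact ⟨-1, 2, Or.inr rfl, by norm_num, by simp [IsUnit.unit_spec]⟩

/-! ### The prime elements above `30` -/

/-- **A prime element of `𝓞 K3` dividing `30 = 2 · 5 · (−ζ²λ²)` is associated to `λ`, `2` or `5`.**
[cite: IrelandRosen1990, Prop. 9.1.4] -/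
theorem associated_of_prime_of_dvd_thirty {q : 𝓞 K3} (hq : Prime q) (h : q ∣ 30) :
    Associated q lamInt ∨ Associated q 2 ∨ Associated q 5 := by
  have h30 : (30 : 𝓞 K3) = 2 * 5 * -(zetaInt ^ 2 * lamInt ^ 2) := by
    rw [← three_eq_neg_zetaInt_sq_mul_lamInt_sq]; norm_num
  rw [h30] at h
  rcases hq.dvd_or_dvd h with h25 | h3
  · rcases hq.dvd_or_dvd h25 with h2 | h5
    · exact Or.inr (Or.inl (hq.irreducible.associated_of_dvd prime_two.irreducible h2))
    · exact Or.inr (Or.inr (hq.irreducible.associated_of_dvd prime_five.irreducible h5))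
  · rw [dvd_neg] at h3
    rcases hq.dvd_or_dvd h3 with hz | hl
    · -- `ζ` is a unit
      exfalso
      have hu : IsUnit (zetaInt ^ 2) :=
        (isPrimitiveRoot_zeta.toInteger_isPrimitiveRoot.isUnit (by norm_num)).pow 2
      exact hq.not_unit (isUnit_of_dvd_unit hz hu)
    · exact Or.inl (hq.irreducible.associated_of_dvd prime_lamInt.irreducible
        (hq.dvd_of_dvd_pow hl))

end K3

end Literature.NumberTheory.NumberFields

end
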